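import Mathlib.Analysis.InnerProductSpace.PiL2
import Mathlib.Analysis.Calculus.FDeriv.Add
import Mathlib.Analysis.Calculus.ContDiff.Operations
import Mathlib.MeasureTheory.Function.LpSeminorm.Basic
import Mathlib.MeasureTheory.Integral.Lebesgue.Add
import Mathlib.MeasureTheory.Measure.Haar.InnerProductSpace
import HarnessLib

/-!
# Squared `L²` Sobolev energies of smooth maps, in recursive directional form
# (topic `Analysis/PDE`)

Analytic layer of the programme to prove short-time existence for quasilinear strictly
parabolic systems on a closed manifold (hypothesis `hQL` of
`Literature.Geometry.Riemannian.ricciFlow_shortTime_existence_of_quasilinear`). The energy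
estimates of the heat flow in the tree (`FluidPDE/HeatDuhamelEnergy.lean`,
`PDE/HeatForwardDuhamel.lean`, `PDE/HeatFreeFlow*.lean`) control `∫‖V‖²`, `∫Σᵢ‖∂ᵢV‖²` and
`∫Σᵢⱼ‖∂ⱼ∂ᵢV‖²` along the standard orthonormal frame `(eᵢ)`, and derivatives fall on the data.
The bookkeeping device that lifts such order-`0` statements to every Sobolev order by a plain
induction is the **recursive directional energy**

* `sobolevEnergy 0 f = ∫ ‖f‖²`, `sobolevEnergy (k+1) f = ∫ ‖f‖² + Σᵢ sobolevEnergy k (∂ᵢ f)`,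
  `∂ᵢ f = fderiv ℝ f · eᵢ` (an `ℝ≥0∞`-valued functional of `f : E → F`, `E` a
  finite-dimensional real inner product space with its Haar volume), i.e. the squared sum-form
  `H^k` norm `Σ_{|β| ≤ k} ‖∂_β f‖₂²` over ordered words `β` in the frame (Adams, *Sobolev
  Spaces*, ¶3.1; Evans, *PDE*, §5.2.2 — the `L²`-based `W^{k,2}` norm in sum form, squared).

This file proves its elementary calculus: unfolding, monotonicity in `k`
(`sobolevEnergy_mono`), the value on `0`, subadditivity `E(f+g) ≤ 2E(f) + 2E(g)`
(`sobolevEnergy_add_le`), negation and differences, homogeneity `E(c • f) = ‖c‖ₑ² E(f)`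
(`sobolevEnergy_const_smul`), finite sums (`sobolevEnergy_sum_le`), post-composition with a
continuous linear map `E(L ∘ f) ≤ ‖L‖ₑ² E(f)` (`sobolevEnergy_clm_comp_le`), and the
first-order control `Σᵢ E_k(∂ᵢf) ≤ E_{k+1}(f)`, `E_0(f) ≤ E_k(f)`.

Everything is proved; no named fact and no `sorry` is introduced.

## References

* R. A. Adams, *Sobolev Spaces*, Academic Press 1975, ¶3.1 (the norms `‖u‖_{m,p}`). [Adams1975]
* L. C. Evans, *Partial Differential Equations*, 2nd ed., AMS 2010, §5.2.2. [Evans2010]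
-/

noncomputable section

open MeasureTheory Set Function Filter Topology
open scoped ENNReal ContDiff

namespace Literature.Analysis.PDE

variable {E : Type*} [NormedAddCommGroup E] [InnerProductSpace ℝ E] [FiniteDimensional ℝ E]
  [MeasurableSpace E] [BorelSpace E]
variable {F : Type*} [NormedAddCommGroup F] [NormedSpace ℝ F]

/-- **The recursive directional Sobolev energy** `E_k(f)`: `E_0(f) = ∫ ‖f‖²` and
`E_{k+1}(f) = ∫ ‖f‖² + Σᵢ E_k(∂ᵢ f)` with `∂ᵢ f (x) = Df(x) eᵢ` along the standard orthonormal
frame — the squared sum-form `H^k` norm `Σ_{|β| ≤ k} ‖∂_β f‖₂²` (Adams, ¶3.1).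
[cite: Adams1975, ¶3.1] -/
def sobolevEnergy : ℕ → (E → F) → ℝ≥0∞
  | 0, f => ∫⁻ x, ‖f x‖ₑ ^ 2
  | k + 1, f => (∫⁻ x, ‖f x‖ₑ ^ 2) +
      ∑ i, sobolevEnergy k (fun x ↦ fderiv ℝ f x (stdOrthonormalBasis ℝ E i))

/-- Unfolding at order `0`. [folklore] -/
@[simp]
theorem sobolevEnergy_zero_left (f : E → F) : sobolevEnergy 0 f = ∫⁻ x, ‖f x‖ₑ ^ 2 := rfl

/-- Unfolding at order `k + 1`. [folklore] -/
theorem sobolevEnergy_succ (k : ℕ) (f : E → F) :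
    sobolevEnergy (k + 1) f = (∫⁻ x, ‖f x‖ₑ ^ 2) +
      ∑ i, sobolevEnergy k (fun x ↦ fderiv ℝ f x (stdOrthonormalBasis ℝ E i)) := rfl

/-- The `L²` mass is bounded by every energy: `∫ ‖f‖² ≤ E_k(f)`. [folklore] -/
theorem lintegral_sq_le_sobolevEnergy (k : ℕ) (f : E → F) :
    ∫⁻ x, ‖f x‖ₑ ^ 2 ≤ sobolevEnergy k f := by
  cases k with
  | zero => exact le_rfl
  | succ k => exact le_self_add

/-- **First-order control**: `Σᵢ E_k(∂ᵢ f) ≤ E_{k+1}(f)`. [folklore] -/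
theorem sum_sobolevEnergy_fderiv_le (k : ℕ) (f : E → F) :
    ∑ i, sobolevEnergy k (fun x ↦ fderiv ℝ f x (stdOrthonormalBasis ℝ E i)) ≤
      sobolevEnergy (k + 1) f :=
  le_add_self

/-- **Monotonicity in the order**: `E_k(f) ≤ E_{k+1}(f)`. [folklore] -/
theorem sobolevEnergy_le_succ : ∀ (k : ℕ) (f : E → F), sobolevEnergy k f ≤ sobolevEnergy (k + 1) f
  | 0, f => le_self_add
  | k + 1, f => by
    rw [sobolevEnergy_succ k, sobolevEnergy_succ (k + 1)]
    exact add_le_add le_rfl (Finset.sum_le_sum fun i _ ↦ sobolevEnergy_le_succ k _)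

/-- Monotonicity in the order. [folklore] -/
theorem sobolevEnergy_mono {k l : ℕ} (hkl : k ≤ l) (f : E → F) :
    sobolevEnergy k f ≤ sobolevEnergy l f := by
  induction hkl with
  | refl => exact le_rfl
  | step _ ih => exact ih.trans (sobolevEnergy_le_succ _ f)

/-- The energy of the zero map vanishes. [folklore] -/
@[simp]
theorem sobolevEnergy_zero_fun : ∀ k : ℕ, sobolevEnergy k (fun _ : E ↦ (0 : F)) = 0
  | 0 => by simp
  | k + 1 => by
    rw [sobolevEnergy_succ]
    simp [sobolevEnergy_zero_fun k]

/-- **Homogeneity**: `E_k(c • f) = ‖c‖ₑ² E_k(f)` for `f` of class `C^k`. [folklore] -/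
theorem sobolevEnergy_const_smul (k : ℕ) : ∀ {f : E → F}, ContDiff ℝ k f → ∀ c : ℝ,
    sobolevEnergy k (fun x ↦ c • f x) = ‖c‖ₑ ^ 2 * sobolevEnergy k f := by
  induction k with
  | zero =>
    intro f _ c
    simp only [sobolevEnergy_zero_left, enorm_smul, mul_pow]
    rw [lintegral_const_mul' _ _ (by simp)]
  | succ k ih =>
    intro f hf c
    rw [sobolevEnergy_succ, sobolevEnergy_succ, mul_add, Finset.mul_sum]
    congr 1
    · simp only [enorm_smul, mul_pow]
      rw [lintegral_const_mul' _ _ (by simp)]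
    · refine Finset.sum_congr rfl fun i _ ↦ ?_
      have hd : Differentiable ℝ f := hf.differentiable (by simp)
      have h1 : (fun x ↦ fderiv ℝ (fun y ↦ c • f y) x (stdOrthonormalBasis ℝ E i)) =
          fun x ↦ c • fderiv ℝ f x (stdOrthonormalBasis ℝ E i) := by
        funext x
        rw [fderiv_fun_const_smul (hd x)]
        rfl
      rw [h1]
      exact ih ((hf.fderiv_right (m := k) (by norm_cast)).clm_apply contDiff_const) c

/-- Negation does not change the energy (class `C^k`). [folklore] -/
theorem sobolevEnergy_neg (k : ℕ) {f : E → F} (hf : ContDiff ℝ k f) :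
    sobolevEnergy k (fun x ↦ -f x) = sobolevEnergy k f := by
  have h := sobolevEnergy_const_smul k hf (-1)
  simp only [neg_smul, one_smul] at h
  rw [h]
  simp

omit [NormedSpace ℝ F] in
/-- Pointwise: `‖a + b‖ₑ² ≤ 2‖a‖ₑ² + 2‖b‖ₑ²`. [folklore] -/
theorem enorm_add_sq_le (a b : F) : ‖a + b‖ₑ ^ 2 ≤ 2 * ‖a‖ₑ ^ 2 + 2 * ‖b‖ₑ ^ 2 := by
  have h : ‖a + b‖ ^ 2 ≤ 2 * ‖a‖ ^ 2 + 2 * ‖b‖ ^ 2 := by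
    have h1 : ‖a + b‖ ^ 2 ≤ (‖a‖ + ‖b‖) ^ 2 :=
      pow_le_pow_left₀ (norm_nonneg _) (norm_add_le a b) 2
    nlinarith [sq_nonneg (‖a‖ - ‖b‖)]
  have h1 : ‖a + b‖ₑ ^ 2 = ENNReal.ofReal (‖a + b‖ ^ 2) := by
    rw [← ofReal_norm, ENNReal.ofReal_pow (norm_nonneg _)]
  have h2 : 2 * ‖a‖ₑ ^ 2 + 2 * ‖b‖ₑ ^ 2 = ENNReal.ofReal (2 * ‖a‖ ^ 2 + 2 * ‖b‖ ^ 2) := by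
    rw [ENNReal.ofReal_add (by positivity) (by positivity), ENNReal.ofReal_mul zero_le_two,
      ENNReal.ofReal_mul zero_le_two, ← ofReal_norm, ← ofReal_norm,
      ENNReal.ofReal_pow (norm_nonneg _), ENNReal.ofReal_pow (norm_nonneg _)]
    simp
  rw [h1, h2]
  exact ENNReal.ofReal_le_ofReal h

omit [NormedSpace ℝ F] in
/-- The order-`0` subadditivity `∫‖f + g‖² ≤ 2∫‖f‖² + 2∫‖g‖²` for continuous `f`. [folklore] -/
theorem lintegral_enorm_add_sq_le {f g : E → F} (hf : Continuous f) :
    ∫⁻ x, ‖f x + g x‖ₑ ^ 2 ≤ 2 * (∫⁻ x, ‖f x‖ₑ ^ 2) + 2 * (∫⁻ x, ‖g x‖ₑ ^ 2) := by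
  have hm : Measurable fun x ↦ 2 * ‖f x‖ₑ ^ 2 :=
    measurable_const.mul ((continuous_enorm.comp hf).measurable.pow_const 2)
  calc ∫⁻ x, ‖f x + g x‖ₑ ^ 2 ≤ ∫⁻ x, (2 * ‖f x‖ₑ ^ 2 + 2 * ‖g x‖ₑ ^ 2) :=
        lintegral_mono fun x ↦ enorm_add_sq_le _ _
    _ = 2 * (∫⁻ x, ‖f x‖ₑ ^ 2) + 2 * (∫⁻ x, ‖g x‖ₑ ^ 2) := by
        rw [lintegral_add_left hm, lintegral_const_mul' _ _ (by simp),
          lintegral_const_mul' _ _ (by simp)]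

/-- **Subadditivity**: `E_k(f + g) ≤ 2 E_k(f) + 2 E_k(g)` for `f, g` of class `C^k`.
[folklore] -/
theorem sobolevEnergy_add_le (k : ℕ) : ∀ {f g : E → F}, ContDiff ℝ k f → ContDiff ℝ k g →
    sobolevEnergy k (fun x ↦ f x + g x) ≤ 2 * sobolevEnergy k f + 2 * sobolevEnergy k g := by
  induction k with
  | zero =>
    intro f g hf _
    simp only [sobolevEnergy_zero_left]
    exact lintegral_enorm_add_sq_le hf.continuous
  | succ k ih =>
    intro f g hf hg
    rw [sobolevEnergy_succ, sobolevEnergy_succ, sobolevEnergy_succ]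
    have hdf : Differentiable ℝ f := hf.differentiable (by simp)
    have hdg : Differentiable ℝ g := hg.differentiable (by simp)
    have h0 := lintegral_enorm_add_sq_le (g := g) hf.continuous
    have h1 : ∀ i, sobolevEnergy k (fun x ↦ fderiv ℝ (fun y ↦ f y + g y) x
        (stdOrthonormalBasis ℝ E i)) ≤
        2 * sobolevEnergy k (fun x ↦ fderiv ℝ f x (stdOrthonormalBasis ℝ E i)) +
          2 * sobolevEnergy k (fun x ↦ fderiv ℝ g x (stdOrthonormalBasis ℝ E i)) := fun i ↦ by
      have heq : (fun x ↦ fderiv ℝ (fun y ↦ f y + g y) x (stdOrthonormalBasis ℝ E i)) =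
          fun x ↦ fderiv ℝ f x (stdOrthonormalBasis ℝ E i) +
            fderiv ℝ g x (stdOrthonormalBasis ℝ E i) := by
        funext x
        rw [fderiv_fun_add (hdf x) (hdg x)]
        rfl
      rw [heq]
      exact ih ((hf.fderiv_right (m := k) (by norm_cast)).clm_apply contDiff_const)
        ((hg.fderiv_right (m := k) (by norm_cast)).clm_apply contDiff_const)
    set A := ∫⁻ x, ‖f x‖ₑ ^ 2
    set B := ∫⁻ x, ‖g x‖ₑ ^ 2
    set a := fun i ↦ sobolevEnergy k (fun x ↦ fderiv ℝ f x (stdOrthonormalBasis ℝ E i))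
    set b := fun i ↦ sobolevEnergy k (fun x ↦ fderiv ℝ g x (stdOrthonormalBasis ℝ E i))
    calc (∫⁻ x, ‖f x + g x‖ₑ ^ 2) + ∑ i, sobolevEnergy k
          (fun x ↦ fderiv ℝ (fun y ↦ f y + g y) x (stdOrthonormalBasis ℝ E i))
        ≤ (2 * A + 2 * B) + ∑ i, (2 * a i + 2 * b i) :=
          add_le_add h0 (Finset.sum_le_sum fun i _ ↦ h1 i)
      _ = 2 * (A + ∑ i, a i) + 2 * (B + ∑ i, b i) := by
          rw [Finset.sum_add_distrib, ← Finset.mul_sum, ← Finset.mul_sum]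
          ring

/-- Differences: `E_k(f - g) ≤ 2 E_k(f) + 2 E_k(g)` (class `C^k`). [folklore] -/
theorem sobolevEnergy_sub_le (k : ℕ) {f g : E → F} (hf : ContDiff ℝ k f) (hg : ContDiff ℝ k g) :
    sobolevEnergy k (fun x ↦ f x - g x) ≤ 2 * sobolevEnergy k f + 2 * sobolevEnergy k g := by
  have h := sobolevEnergy_add_le k hf hg.neg
  rw [sobolevEnergy_neg k hg] at h
  have heq : (fun x ↦ f x - g x) = fun x ↦ f x + -g x := by
    funext x
    rw [sub_eq_add_neg]
  rw [heq]
  exact h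

/-- **Finite sums**: `E_k(Σ_{i ∈ s} fᵢ) ≤ 2^{#s} Σ_{i ∈ s} E_k(fᵢ)` (a crude but sufficient
bound; class `C^k`). [folklore] -/
theorem sobolevEnergy_sum_le (k : ℕ) {ι : Type*} (s : Finset ι) {f : ι → E → F}
    (hf : ∀ i ∈ s, ContDiff ℝ k (f i)) :
    sobolevEnergy k (fun x ↦ ∑ i ∈ s, f i x) ≤ 2 ^ s.card * ∑ i ∈ s, sobolevEnergy k (f i) := by
  classical
  induction s using Finset.induction_on with
  | empty => simp
  | insert a s ha ih =>
    have hfa := hf a (Finset.mem_insert_self a s)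
    have hfs : ∀ i ∈ s, ContDiff ℝ k (f i) := fun i hi ↦ hf i (Finset.mem_insert_of_mem hi)
    have hsum : ContDiff ℝ k fun x ↦ ∑ i ∈ s, f i x := ContDiff.sum fun i hi ↦ hfs i hi
    simp only [Finset.sum_insert ha, Finset.card_insert_of_notMem ha]
    have h2 : (2 : ℝ≥0∞) ≤ 2 ^ (s.card + 1) := by
      calc (2 : ℝ≥0∞) = 2 ^ 1 := (pow_one _).symm
        _ ≤ 2 ^ (s.card + 1) := pow_le_pow_right₀ one_le_two (by omega)
    calc sobolevEnergy k (fun x ↦ f a x + ∑ i ∈ s, f i x)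
        ≤ 2 * sobolevEnergy k (f a) + 2 * sobolevEnergy k (fun x ↦ ∑ i ∈ s, f i x) :=
          sobolevEnergy_add_le k hfa hsum
      _ ≤ 2 * sobolevEnergy k (f a) + 2 * (2 ^ s.card * ∑ i ∈ s, sobolevEnergy k (f i)) := by
          gcongr
          exact ih hfs
      _ = 2 * sobolevEnergy k (f a) + 2 ^ (s.card + 1) * ∑ i ∈ s, sobolevEnergy k (f i) := by
          rw [pow_succ]; ring
      _ ≤ 2 ^ (s.card + 1) * sobolevEnergy k (f a) +
          2 ^ (s.card + 1) * ∑ i ∈ s, sobolevEnergy k (f i) := by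
          gcongr
      _ = 2 ^ (s.card + 1) * (sobolevEnergy k (f a) + ∑ i ∈ s, sobolevEnergy k (f i)) := by
          rw [mul_add]

/-- **Post-composition with a continuous linear map**: `E_k(L ∘ f) ≤ ‖L‖ₑ² E_k(f)`
(class `C^k`; Adams ¶3.1: bounded changes of the dependent variable). [folklore] -/
theorem sobolevEnergy_clm_comp_le {G : Type*} [NormedAddCommGroup G] [NormedSpace ℝ G]
    (L : F →L[ℝ] G) (k : ℕ) : ∀ {f : E → F}, ContDiff ℝ k f →
    sobolevEnergy k (fun x ↦ L (f x)) ≤ ‖L‖ₑ ^ 2 * sobolevEnergy k f := by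
  induction k with
  | zero =>
    intro f _
    simp only [sobolevEnergy_zero_left]
    rw [← lintegral_const_mul' _ _ (by simp)]
    refine lintegral_mono fun x ↦ ?_
    rw [← mul_pow]
    exact pow_le_pow_left' (L.le_opENorm (f x)) 2
  | succ k ih =>
    intro f hf
    rw [sobolevEnergy_succ, sobolevEnergy_succ, mul_add, Finset.mul_sum]
    have hd : Differentiable ℝ f := hf.differentiable (by simp)
    refine add_le_add ?_ (Finset.sum_le_sum fun i _ ↦ ?_)
    · rw [← lintegral_const_mul' _ _ (by simp)]
      refine lintegral_mono fun x ↦ ?_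
      rw [← mul_pow]
      exact pow_le_pow_left' (L.le_opENorm (f x)) 2
    · have heq : (fun x ↦ fderiv ℝ (fun y ↦ L (f y)) x (stdOrthonormalBasis ℝ E i)) =
          fun x ↦ L (fderiv ℝ f x (stdOrthonormalBasis ℝ E i)) := by
        funext x
        have h := (L.hasFDerivAt.comp x (hd x).hasFDerivAt).fderiv
        rw [show (fun y ↦ L (f y)) = (L : F → G) ∘ f from rfl, h]
        rfl
      rw [heq]
      exact ih ((hf.fderiv_right (m := k) (by norm_cast)).clm_apply contDiff_const)

end Literature.Analysis.PDE

end
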